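import Mathlib
import Literature.ModelTheory.ExponentialFields.SemialgebraicInterior
import Summits.KontsevichZagierPeriods.KontsevichZagierPeriods.Theses.InverseLandau

/-!
# `TateLifting`, line `Sketch`, stub `stub_tateToGen` — Tate fibres are generic fibres

Crux stmt-KontsevichZagierPeriods-9129 (`Summit.KontsevichZagierPeriods.KontsevichZagierPeriods.Theses.InverseLandau.TateLifting`).
Converse of the landed `tateLifting_genFibres_subset_tateFibres`: assuming analytic continuation
of vanishing Tate periods (stub `stub_tateAnalyticContinuation`, hypothesis here), every TATE
FIBRE — the fibre at a real-algebraic `ϖ₀ ∈ (0,ε)` of a one-parameter rational Tate family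
(`Q(z,0) ≡ c₀ ≠ 0`) admissible on `[0,1]ⁿ × (0,ε)` with cube integrals vanishing on `(0,ε)` — is a
GENERIC FIBRE with `k = 1` parameter: by compactness of the cube and `Q(z,0) = c₀ ≠ 0` there is
`δ > 0` with `Q ≠ 0` on `[0,1]ⁿ × [−δ, δ]`, so the family is admissible on the open interval
`U = (−δ, ε) ∋ 0`; by analytic continuation its cube integrals vanish on all of `U`; the corner path
is `γ(t) = tϖ₀`; and `Fin.append z (fun _ => w) = Fin.snoc z w` identifies the two parametrisations.
-/

noncomputable section

namespace Summit.KontsevichZagierPeriods.InverseLandau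

open Literature.NumberTheory.Transcendental

/-- **Tate fibres are generic fibres** (stub `stub_tateToGen` of line `Sketch` for crux
`TateLifting`): analytic continuation `→ tateFibres ⊆ genFibres`, both sets written out. [folklore] -/
theorem tateLifting_tateToGen :
    -- TateAnalyticContinuation
    (∀ (n : ℕ) (P Q : MvPolynomial (Fin (n + 1)) ℚ) (a b c d : ℝ), a ≤ c → c < d → d ≤ b →
      (∀ (z : Fin n → ℝ) (ϖ : ℝ), (∀ i, z i ∈ Set.Icc (0 : ℝ) 1) → ϖ ∈ Set.Icc a b →
        MvPolynomial.aeval (Fin.snoc z ϖ : Fin (n + 1) → ℝ) Q ≠ 0) →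
      (∀ ϖ ∈ Set.Ioo c d, ∫ z in Set.pi Set.univ (fun _ : Fin n => Set.Ioo (0 : ℝ) 1),
        MvPolynomial.aeval (Fin.snoc z ϖ : Fin (n + 1) → ℝ) P /
          MvPolynomial.aeval (Fin.snoc z ϖ : Fin (n + 1) → ℝ) Q = 0) →
      ∀ ϖ ∈ Set.Icc a b, ∫ z in Set.pi Set.univ (fun _ : Fin n => Set.Ioo (0 : ℝ) 1),
        MvPolynomial.aeval (Fin.snoc z ϖ : Fin (n + 1) → ℝ) P /
          MvPolynomial.aeval (Fin.snoc z ϖ : Fin (n + 1) → ℝ) Q = 0) →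
    -- tateFibres ⊆ genFibres
    {d : KZ.FormalRep | ∃ (n : ℕ) (P Q : MvPolynomial (Fin (n + 1)) ℚ) (ε ϖ₀ : ℝ)
        (r : KZ.IntegralRep n), 0 < ε ∧
      (∃ c₀ : ℚ, c₀ ≠ 0 ∧ ∀ z : Fin n → ℝ,
        MvPolynomial.aeval (Fin.snoc z (0 : ℝ) : Fin (n + 1) → ℝ) Q = (c₀ : ℝ)) ∧
      (∀ (z : Fin n → ℝ) (ϖ : ℝ), (∀ i, z i ∈ Set.Icc (0 : ℝ) 1) → ϖ ∈ Set.Ioo 0 ε →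
        MvPolynomial.aeval (Fin.snoc z ϖ : Fin (n + 1) → ℝ) Q ≠ 0) ∧
      (∀ ϖ ∈ Set.Ioo (0 : ℝ) ε, ∫ z in Set.pi Set.univ (fun _ : Fin n => Set.Ioo (0 : ℝ) 1),
        MvPolynomial.aeval (Fin.snoc z ϖ : Fin (n + 1) → ℝ) P /
          MvPolynomial.aeval (Fin.snoc z ϖ : Fin (n + 1) → ℝ) Q = 0) ∧
      IsAlgebraic ℚ ϖ₀ ∧ ϖ₀ ∈ Set.Ioo 0 ε ∧
      r.domain = Set.pi Set.univ (fun _ : Fin n => Set.Ioo (0 : ℝ) 1) ∧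
      Set.EqOn r.integrand (fun z => MvPolynomial.aeval (Fin.snoc z ϖ₀ : Fin (n + 1) → ℝ) P /
        MvPolynomial.aeval (Fin.snoc z ϖ₀ : Fin (n + 1) → ℝ) Q) r.domain ∧
      d = KZ.of r} ⊆
    {d : KZ.FormalRep | ∃ (n k : ℕ) (P Q : MvPolynomial (Fin (n + k)) ℚ) (U : Set (Fin k → ℝ))
        (γ : ℝ → (Fin k → ℝ)) (a : Fin k → ℝ) (r : KZ.IntegralRep n),
      IsOpen U ∧ ContinuousOn γ (Set.Icc 0 1) ∧ γ 0 = 0 ∧ γ 1 = a ∧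
      (∀ t ∈ Set.Icc (0 : ℝ) 1, γ t ∈ U) ∧
      (∃ c₀ : ℚ, c₀ ≠ 0 ∧ ∀ z : Fin n → ℝ,
        MvPolynomial.aeval (Fin.append z (0 : Fin k → ℝ)) Q = (c₀ : ℝ)) ∧
      (∀ (z : Fin n → ℝ) (u : Fin k → ℝ), (∀ i, z i ∈ Set.Icc (0 : ℝ) 1) → u ∈ U →
        MvPolynomial.aeval (Fin.append z u) Q ≠ 0) ∧
      (∀ u ∈ U, ∫ z in Set.pi Set.univ (fun _ : Fin n => Set.Ioo (0 : ℝ) 1),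
        MvPolynomial.aeval (Fin.append z u) P / MvPolynomial.aeval (Fin.append z u) Q = 0) ∧
      (∀ j, IsAlgebraic ℚ (a j)) ∧
      r.domain = Set.pi Set.univ (fun _ : Fin n => Set.Ioo (0 : ℝ) 1) ∧
      Set.EqOn r.integrand (fun z => MvPolynomial.aeval (Fin.append z a) P /
        MvPolynomial.aeval (Fin.append z a) Q) r.domain ∧
      d = KZ.of r} := by
  intro hAC d hd
  obtain ⟨n, P, Q, ε, ϖ₀, r, hε, ⟨c₀, hc₀, hQ0⟩, hadm, hvan, halg, hϖ₀, hdom, hint, rfl⟩ := hd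
  -- (b) `Q(z, ϖ)` is jointly continuous in `(ϖ, z)`
  have hg : Continuous fun p : ℝ × (Fin n → ℝ) =>
      MvPolynomial.aeval (Fin.snoc p.2 p.1 : Fin (n + 1) → ℝ) Q :=
    (Literature.ModelTheory.ExponentialFields.continuous_aeval_real Q).comp
      (Continuous.finSnoc (A := fun _ : Fin (n + 1) => ℝ) continuous_snd continuous_fst)
  -- tube lemma over the compact closed cube: `Q ≠ 0` on `[0,1]ⁿ × (-δ, δ)`
  have hev : ∀ᶠ ϖ in nhds (0 : ℝ), ∀ z ∈ Set.pi Set.univ (fun _ : Fin n => Set.Icc (0 : ℝ) 1),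
      MvPolynomial.aeval (Fin.snoc z ϖ : Fin (n + 1) → ℝ) Q ≠ 0 := by
    refine (isCompact_univ_pi fun _ => isCompact_Icc).eventually_forall_of_forall_eventually
      fun z _ => ?_
    have h0 : MvPolynomial.aeval (Fin.snoc z (0 : ℝ) : Fin (n + 1) → ℝ) Q ≠ 0 := by
      rw [hQ0 z]; exact_mod_cast hc₀
    exact hg.continuousAt.eventually_ne h0
  obtain ⟨δ, hδ, hδQ⟩ := Metric.eventually_nhds_iff.mp hev
  -- (d) admissibility on the enlarged window `[0,1]ⁿ × (-δ, ε)`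
  have hadmI : ∀ (z : Fin n → ℝ) (ϖ : ℝ), (∀ i, z i ∈ Set.Icc (0 : ℝ) 1) →
      ϖ ∈ Set.Ioo (-δ) ε → MvPolynomial.aeval (Fin.snoc z ϖ : Fin (n + 1) → ℝ) Q ≠ 0 := by
    intro z ϖ hz hϖ
    rcases lt_or_ge ϖ δ with h | h
    · have hϖ' : dist ϖ 0 < δ := by
        rw [Real.dist_0_eq_abs, abs_lt]; exact ⟨hϖ.1, h⟩
      exact hδQ hϖ' z (Set.mem_univ_pi.mpr hz)
    · exact hadm z ϖ hz ⟨lt_of_lt_of_le hδ h, hϖ.2⟩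
  -- (e) vanishing on the enlarged window, by analytic continuation from `(ε/4, ε/2)`
  have hvanI : ∀ ϖ₁ ∈ Set.Ioo (-δ) ε,
      ∫ z in Set.pi Set.univ (fun _ : Fin n => Set.Ioo (0 : ℝ) 1),
        MvPolynomial.aeval (Fin.snoc z ϖ₁ : Fin (n + 1) → ℝ) P /
          MvPolynomial.aeval (Fin.snoc z ϖ₁ : Fin (n + 1) → ℝ) Q = 0 := by
    intro ϖ₁ hϖ₁
    refine hAC n P Q (min ϖ₁ (-δ / 2)) (max ϖ₁ (ε / 2)) (ε / 4) (ε / 2)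
      ((min_le_right _ _).trans (by linarith)) (by linarith) (le_max_right _ _) ?_ ?_ ϖ₁
      ⟨min_le_left _ _, le_max_left _ _⟩
    · intro z ϖ hz hϖ
      exact hadmI z ϖ hz ⟨(lt_min hϖ₁.1 (by linarith)).trans_le hϖ.1,
        hϖ.2.trans_lt (max_lt hϖ₁.2 (by linarith))⟩
    · intro ϖ hϖ
      exact hvan ϖ ⟨by linarith [hϖ.1], hϖ.2.trans (by linarith)⟩
  -- (c), (f)-(h): the generic-fibre datum with `k = 1`, `U = (-δ, ε)`, `γ t = t • ϖ₀`
  refine ⟨n, 1, P, Q, {u | u 0 ∈ Set.Ioo (-δ) ε}, fun t _ => t * ϖ₀, fun _ => ϖ₀, r,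
    isOpen_Ioo.preimage (continuous_apply 0), ?_, ?_, ?_, ?_, ⟨c₀, hc₀, fun z => ?_⟩, ?_, ?_,
    fun _ => halg, hdom, ?_, rfl⟩
  · fun_prop
  · funext j; simp
  · funext j; simp
  · intro t ht
    exact ⟨lt_of_lt_of_le (by linarith) (mul_nonneg ht.1 hϖ₀.1.le),
      (mul_le_of_le_one_left hϖ₀.1.le ht.2).trans_lt hϖ₀.2⟩
  · rw [Fin.append_right_eq_snoc]
    exact hQ0 z
  · intro z u hz hu
    rw [Fin.append_right_eq_snoc]
    exact hadmI z (u 0) hz hu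
  · intro u hu
    simp only [Fin.append_right_eq_snoc]
    exact hvanI (u 0) hu
  · intro z hz
    simp only [Fin.append_right_eq_snoc]
    exact hint hz

end Summit.KontsevichZagierPeriods.InverseLandau

end
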